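import Literature.Analysis.FluidPDE.PeriodicLerayLimitGradient
import Literature.Analysis.FluidPDE.PeriodicLerayMollifiedDrift
import Literature.Analysis.FluidPDE.DistributionalToWeak
import HarnessLib

/-!
# [BT1] proof of Theorem 2.4, the limit `ε → 0`, VI: the limit solves the Leray system in the
  sense of distributions, and its slices are divergence free

Analysis/FluidPDE proof file (theorems only, no new definitions, no named facts), sixth part of
the discharge of the named fact `Literature.Analysis.FluidPDE.bradshawTsai2017_thm_2_4_limit`
(`PeriodicLerayExistence.lean`; Bradshaw–Tsai, Ann. Henri Poincaré 18 (2017) =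
arXiv:1510.07504 [BT1], §2, proof of Thm 2.4): "this convergence is strong enough to ensure
that `(u, p)` solves (2.1) in the distributional sense".

Along a sequence of `T`-periodic weak solutions `(U_k, p_k)` of the mollified perturbed Leray
systems at scales `ε_k → 0⁺` (`IsMollifiedPeriodicWeakSolution T W η ε_k C U_k p_k`) with
`U_k → U` in `L²` of every cylinder `Q_n = (−n−1, n+1) × B(0, n+1)`, `η_{ε_k} * U_k → U` in
`L³` of every cylinder, and `∫_Q p_k h → ∫_Q p h` for every cylinder `Q` and `h ∈ L^{5/2}(Q)`
(the outputs of parts II, III, V), the pair `(u, p) = (U + W, p)` satisfies the first line of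
(2.1) in `𝒟'(ℝ × ℝ³)` in the form of `IsSuitablePeriodicWeakSolution.distributional`
(`distributional_limit`: every term of `IsMollifiedPeriodicWeakSolution.distributional` passes
to the limit on the cylinder carrying the test field — linear terms by `L²` convergence, the
drift term `⟪U_k, Dψ (W + η_{ε_k} * U_k)⟫` by the joint `L²` convergence of the two factors
(`tendsto_integral_inner_clm_apply₂`), the pressure term by weak convergence), and almost every
slice `u(s)` is weakly divergence free (`ae_isWeaklyDivFree_limit`: the slice pairings of the
divergence-free `U_k(s)` converge for a.e. `s`, the separability argument
`ae_isWeaklyDivFree_of_forall_test`, and `div W = 0` classically).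

## References

* Z. Bradshaw, T.-P. Tsai, Ann. Henri Poincaré 18 (2017) 1095–1119 = arXiv:1510.07504, §2,
  proof of Thm 2.4 [BradshawTsai2017AHP].
* R. Temam, *Navier–Stokes equations* (1977/79), Ch. III, §3 (passage to the limit) [Temam1979].
-/

noncomputable section

open MeasureTheory TopologicalSpace Set Function Filter Metric Bornology
open scoped NNReal ENNReal Topology InnerProductSpace RealInnerProductSpace Laplacian

namespace Literature.Analysis.FluidPDE

namespace BradshawTsai2017

/-! ### Bilinear pairings of two `L²`-convergent sequences -/

section Pairings

variable {X : Type*} [MeasurableSpace X] {μ : Measure X}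
variable {E : Type*} [NormedAddCommGroup E] [InnerProductSpace ℝ E]

/-- **Pairings `∫ ⟪fₖ, L gₖ⟫` of two `L²`-convergent sequences pass to the limit**: if
`fₖ → f`, `gₖ → g` in `L²(μ)` (finite measure) and `L` is a bounded measurable operator field,
then `∫ ⟪fₖ, L gₖ⟫ → ∫ ⟪f, L g⟫`
(`|⟪a, Lb⟫ − ⟪a', Lb'⟫| ≤ ‖L‖ (‖a − a'‖ ‖b‖ + ‖a'‖ ‖b − b'‖)` and Cauchy–Schwarz). [folklore] -/
theorem tendsto_integral_inner_clm_apply₂ [IsFiniteMeasure μ]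
    {f g : ℕ → X → E} {f₀ g₀ : X → E} (hf : ∀ k, MemLp (f k) 2 μ) (hf₀ : MemLp f₀ 2 μ)
    (hg : ∀ k, MemLp (g k) 2 μ) (hg₀ : MemLp g₀ 2 μ)
    (hfl : Tendsto (fun k => eLpNorm (f k - f₀) 2 μ) atTop (𝓝 0))
    (hgl : Tendsto (fun k => eLpNorm (g k - g₀) 2 μ) atTop (𝓝 0)) {L : X → E →L[ℝ] E}
    (hL : AEStronglyMeasurable L μ) {C : ℝ} (hC0 : 0 ≤ C) (hC : ∀ x, ‖L x‖ ≤ C) :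
    Tendsto (fun k => ∫ x, ⟪f k x, L x (g k x)⟫ ∂μ) atTop (𝓝 (∫ x, ⟪f₀ x, L x (g₀ x)⟫ ∂μ)) := by
  have happ : Continuous (uncurry fun (T : E →L[ℝ] E) (v : E) => T v) :=
    isBoundedBilinearMap_apply.continuous
  -- integrability of the pairings
  have hint : ∀ {a b : X → E}, MemLp a 2 μ → MemLp b 2 μ → Integrable (fun x => ⟪a x, L x (b x)⟫) μ := by
    intro a b ha hb
    have hm : AEStronglyMeasurable (fun x => L x (b x)) μ := happ.comp_aestronglyMeasurable₂ hL hb.1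
    have hLb : MemLp (fun x => L x (b x)) 2 μ :=
      MemLp.of_le_mul (c := C) hb hm (Eventually.of_forall fun x =>
        (ContinuousLinearMap.le_opNorm _ _).trans (mul_le_mul_of_nonneg_right (hC x) (norm_nonneg _)))
    have h1 : Integrable (fun x => ‖a x‖ * ‖L x (b x)‖) μ := ha.norm.integrable_mul hLb.norm
    exact h1.mono' (ha.1.inner hm) (Eventually.of_forall fun x => norm_inner_le_norm _ _)
  -- the bound
  set d : ℕ → ℝ≥0∞ := fun k => ENNReal.ofReal C *
    (eLpNorm (f k - f₀) 2 μ * (eLpNorm (g k - g₀) 2 μ + eLpNorm g₀ 2 μ) + eLpNorm f₀ 2 μ * eLpNorm (g k - g₀) 2 μ) with hd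
  have hG0 : eLpNorm g₀ 2 μ ≠ ⊤ := hg₀.2.ne
  have hF0 : eLpNorm f₀ 2 μ ≠ ⊤ := hf₀.2.ne
  have hdt : Tendsto d atTop (𝓝 0) := by
    have h1 : Tendsto (fun k => eLpNorm (g k - g₀) 2 μ + eLpNorm g₀ 2 μ) atTop (𝓝 (0 + eLpNorm g₀ 2 μ)) :=
      hgl.add tendsto_const_nhds
    have h2 := ENNReal.Tendsto.mul hfl (Or.inr (by simpa using hG0)) h1 (Or.inr ENNReal.zero_ne_top)
    rw [zero_mul] at h2
    have h3 := ENNReal.Tendsto.const_mul hgl (a := eLpNorm f₀ 2 μ) (Or.inr hF0)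
    rw [mul_zero] at h3
    have h4 := ENNReal.Tendsto.const_mul (h2.add h3) (a := ENNReal.ofReal C) (Or.inr ENNReal.ofReal_ne_top)
    simpa [hd] using h4
  have hdr : Tendsto (fun k => (d k).toReal) atTop (𝓝 0) := by
    have h := (ENNReal.tendsto_toReal ENNReal.zero_ne_top).comp hdt
    rwa [ENNReal.toReal_zero] at h
  have hdtop : ∀ k, d k ≠ ⊤ := fun k => ENNReal.mul_ne_top ENNReal.ofReal_ne_top (ENNReal.add_ne_top.2
    ⟨ENNReal.mul_ne_top ((hf k).sub hf₀).eLpNorm_ne_top (ENNReal.add_ne_top.2 ⟨((hg k).sub hg₀).eLpNorm_ne_top, hG0⟩),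
      ENNReal.mul_ne_top hF0 ((hg k).sub hg₀).eLpNorm_ne_top⟩)
  rw [tendsto_iff_norm_sub_tendsto_zero]
  refine squeeze_zero (fun k => norm_nonneg _) (fun k => ?_) hdr
  rw [Real.norm_eq_abs, ← integral_sub (hint (hf k) (hg k)) (hint hf₀ hg₀)]
  refine abs_integral_le_toReal_of_lintegral_le (hdtop k) ?_
  -- pointwise bound
  have hLb : ∀ x v, ‖L x v‖ ≤ C * ‖v‖ := fun x v =>
    (ContinuousLinearMap.le_opNorm _ _).trans (mul_le_mul_of_nonneg_right (hC x) (norm_nonneg _))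
  have hpt : ∀ x, ‖⟪f k x, L x (g k x)⟫ - ⟪f₀ x, L x (g₀ x)⟫‖ₑ ≤
      ENNReal.ofReal C * (‖f k x - f₀ x‖ₑ * ‖g k x‖ₑ + ‖f₀ x‖ₑ * ‖g k x - g₀ x‖ₑ) := fun x => by
    rw [← ofReal_norm, ← ofReal_norm, ← ofReal_norm, ← ofReal_norm, ← ofReal_norm,
      ← ENNReal.ofReal_mul (norm_nonneg _), ← ENNReal.ofReal_mul (norm_nonneg _),
      ← ENNReal.ofReal_add (by positivity) (by positivity), ← ENNReal.ofReal_mul hC0]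
    refine ENNReal.ofReal_le_ofReal ?_
    have e : ⟪f k x, L x (g k x)⟫ - ⟪f₀ x, L x (g₀ x)⟫ =
        ⟪f k x - f₀ x, L x (g k x)⟫ + ⟪f₀ x, L x (g k x - g₀ x)⟫ := by
      simp only [inner_sub_left, map_sub, inner_sub_right]; ring
    rw [e]
    calc ‖⟪f k x - f₀ x, L x (g k x)⟫ + ⟪f₀ x, L x (g k x - g₀ x)⟫‖
        ≤ ‖⟪f k x - f₀ x, L x (g k x)⟫‖ + ‖⟪f₀ x, L x (g k x - g₀ x)⟫‖ := norm_add_le _ _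
      _ ≤ ‖f k x - f₀ x‖ * (C * ‖g k x‖) + ‖f₀ x‖ * (C * ‖g k x - g₀ x‖) :=
          add_le_add ((norm_inner_le_norm _ _).trans (mul_le_mul_of_nonneg_left (hLb _ _) (norm_nonneg _)))
            ((norm_inner_le_norm _ _).trans (mul_le_mul_of_nonneg_left (hLb _ _) (norm_nonneg _)))
      _ = C * (‖f k x - f₀ x‖ * ‖g k x‖ + ‖f₀ x‖ * ‖g k x - g₀ x‖) := by ring
  have hF : AEMeasurable (fun x => ‖f k x - f₀ x‖ₑ) μ := ((hf k).1.sub hf₀.1).enorm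
  have hF0m : AEMeasurable (fun x => ‖f₀ x‖ₑ) μ := hf₀.1.enorm
  have hGm : AEMeasurable (fun x => ‖g k x‖ₑ) μ := (hg k).1.enorm
  have hGd : AEMeasurable (fun x => ‖g k x - g₀ x‖ₑ) μ := ((hg k).1.sub hg₀.1).enorm
  calc ∫⁻ x, ‖⟪f k x, L x (g k x)⟫ - ⟪f₀ x, L x (g₀ x)⟫‖ₑ ∂μ
      ≤ ∫⁻ x, ENNReal.ofReal C * (‖f k x - f₀ x‖ₑ * ‖g k x‖ₑ + ‖f₀ x‖ₑ * ‖g k x - g₀ x‖ₑ) ∂μ := lintegral_mono hpt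
    _ = ENNReal.ofReal C * ((∫⁻ x, ‖f k x - f₀ x‖ₑ * ‖g k x‖ₑ ∂μ) + ∫⁻ x, ‖f₀ x‖ₑ * ‖g k x - g₀ x‖ₑ ∂μ) := by
        have hm1 : AEMeasurable (fun x => ‖f k x - f₀ x‖ₑ * ‖g k x‖ₑ) μ := hF.mul hGm
        have hm2 : AEMeasurable (fun x => ‖f k x - f₀ x‖ₑ * ‖g k x‖ₑ + ‖f₀ x‖ₑ * ‖g k x - g₀ x‖ₑ) μ :=
          hm1.add (hF0m.mul hGd)
        rw [lintegral_const_mul'' _ hm2, lintegral_add_left' hm1]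
    _ ≤ ENNReal.ofReal C * (eLpNorm (f k - f₀) 2 μ * eLpNorm (g k) 2 μ + eLpNorm f₀ 2 μ * eLpNorm (g k - g₀) 2 μ) := by
        gcongr
        · calc ∫⁻ x, ‖f k x - f₀ x‖ₑ * ‖g k x‖ₑ ∂μ
              ≤ (∫⁻ x, ‖f k x - f₀ x‖ₑ ^ (2 : ℝ) ∂μ) ^ (1 / (2 : ℝ)) * (∫⁻ x, ‖g k x‖ₑ ^ (2 : ℝ) ∂μ) ^ (1 / (2 : ℝ)) :=
                ENNReal.lintegral_mul_le_Lp_mul_Lq μ Real.HolderConjugate.two_two hF hGm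
            _ = eLpNorm (f k - f₀) 2 μ * eLpNorm (g k) 2 μ := by
                rw [← FunctionSpaces.lintegral_rpow_two_eq_eLpNorm, ← FunctionSpaces.lintegral_rpow_two_eq_eLpNorm]; rfl
        · calc ∫⁻ x, ‖f₀ x‖ₑ * ‖g k x - g₀ x‖ₑ ∂μ
              ≤ (∫⁻ x, ‖f₀ x‖ₑ ^ (2 : ℝ) ∂μ) ^ (1 / (2 : ℝ)) * (∫⁻ x, ‖g k x - g₀ x‖ₑ ^ (2 : ℝ) ∂μ) ^ (1 / (2 : ℝ)) :=
                ENNReal.lintegral_mul_le_Lp_mul_Lq μ Real.HolderConjugate.two_two hF0m hGd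
            _ = eLpNorm f₀ 2 μ * eLpNorm (g k - g₀) 2 μ := by
                rw [← FunctionSpaces.lintegral_rpow_two_eq_eLpNorm, ← FunctionSpaces.lintegral_rpow_two_eq_eLpNorm]; rfl
    _ ≤ d k := by
        change _ ≤ ENNReal.ofReal C * (eLpNorm (f k - f₀) 2 μ * (eLpNorm (g k - g₀) 2 μ + eLpNorm g₀ 2 μ) +
          eLpNorm f₀ 2 μ * eLpNorm (g k - g₀) 2 μ)
        gcongr
        calc eLpNorm (g k) 2 μ = eLpNorm ((g k - g₀) + g₀) 2 μ := by congr 1; funext x; simp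
          _ ≤ eLpNorm (g k - g₀) 2 μ + eLpNorm g₀ 2 μ := eLpNorm_add_le ((hg k).1.sub hg₀.1) hg₀.1 one_le_two

end Pairings

/-! ### The distributional Leray system in the limit -/

section Distributional

/-- A function with `∫⁻ ‖q‖ₑ^{5/3} < ∞` on a finite measure space is integrable there. [folklore] -/
theorem integrable_of_lintegral_rpow_fiveThirds_lt_top {X : Type*} [MeasurableSpace X] {μ : Measure X}
    [IsFiniteMeasure μ] {q : X → ℝ} (hqm : AEStronglyMeasurable q μ)
    (h : ∫⁻ x, ‖q x‖ₑ ^ (5 / 3 : ℝ) ∂μ < ∞) : Integrable q μ := by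
  have h53 : (5 / 3 : ℝ≥0∞) = ENNReal.ofReal (5 / 3) := by
    rw [ENNReal.ofReal_div_of_pos (by norm_num)]; simp
  have hmem : MemLp q (5 / 3 : ℝ≥0∞) μ := by
    refine ⟨hqm, ?_⟩
    rw [eLpNorm_lt_top_iff_lintegral_rpow_enorm_lt_top (by norm_num) (by rw [h53]; simp)]
    rw [h53, ENNReal.toReal_ofReal (by norm_num)]
    exact h
  exact hmem.integrable (by rw [h53]; exact ENNReal.one_le_ofReal.2 (by norm_num))

/-- The weight `Dψ(s,y) y` of a space–time test field is bounded: by `‖Dψ‖ R` when the field is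
supported in `ℝ × B(0, R)`. [folklore] -/
theorem norm_fderiv_slice_apply_self_le {ψ : ℝ → EuclideanSpace ℝ (Fin 3) → EuclideanSpace ℝ (Fin 3)}
    {S : Set ℝ} {R : ℝ} (hsupp : tsupport (uncurry ψ) ⊆ S ×ˢ ball (0 : EuclideanSpace ℝ (Fin 3)) R)
    {Cψ : ℝ} (hC0 : 0 ≤ Cψ) (hDC : ∀ z : ℝ × EuclideanSpace ℝ (Fin 3), ‖fderiv ℝ (ψ z.1) z.2‖ ≤ Cψ)
    (z : ℝ × EuclideanSpace ℝ (Fin 3)) : ‖fderiv ℝ (ψ z.1) z.2 z.2‖ ≤ Cψ * |R| := by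
  by_cases hz : z ∈ tsupport (uncurry ψ)
  · have hy : ‖z.2‖ < R := by simpa using (hsupp hz).2
    exact ((fderiv ℝ (ψ z.1) z.2).le_opNorm z.2).trans
      (mul_le_mul (hDC z) (hy.le.trans (le_abs_self R)) (norm_nonneg _) hC0)
  · rw [(testField_weights_eq_zero_of_notMem_tsupport hz).2.1]
    simp only [_root_.zero_apply, norm_zero]
    positivity

/-- **The limit solves the Leray system in the sense of distributions** ([BT1], proof of Thm 2.4:
"this convergence is strong enough to ensure that `(u, p)` solves (2.1) in the distributional
sense"). Along `T`-periodic weak solutions `(U_k, p_k)` of the mollified perturbed Leray systems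
at scales `ε_k > 0` around the `C¹` profile `W`, with `U_k → U` in `L²` of the cylinders `Q_n`,
`η_{ε_k} * U_k → U` in `L³` of every cylinder and `p_k ⇀ p` weakly on every cylinder (tested
against `L^{5/2}`), the pair `u = U + W`, `p` satisfies
`∫∫ ⟪u, ∂ₛψ + Δψ − 2ψ − (y·∇)ψ + (u·∇)ψ⟫ + p div ψ = 0` for every `ψ ∈ C_c^∞(ℝ × ℝ³; ℝ³)` — each
term of `IsMollifiedPeriodicWeakSolution.distributional` passes to the limit on the cylinder
carrying `ψ`. [cite: BradshawTsai2017AHP, proof of Thm 2.4 ("solves (2.1) in the distributional sense")] -/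
theorem distributional_limit {T : ℝ} (hT : 0 < T)
    {W : ℝ → EuclideanSpace ℝ (Fin 3) → EuclideanSpace ℝ (Fin 3)} (hW : ContDiff ℝ 1 (uncurry W))
    {η : EuclideanSpace ℝ (Fin 3) → ℝ} (hη : IsMollifyingKernel η) {C : ℝ≥0} {ε : ℕ → ℝ} (hε : ∀ k, 0 < ε k)
    {U : ℕ → ℝ → EuclideanSpace ℝ (Fin 3) → EuclideanSpace ℝ (Fin 3)} {p : ℕ → ℝ → EuclideanSpace ℝ (Fin 3) → ℝ}
    (hsol : ∀ k, IsMollifiedPeriodicWeakSolution T W η (ε k) C (U k) (p k))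
    {Ul : ℝ → EuclideanSpace ℝ (Fin 3) → EuclideanSpace ℝ (Fin 3)}
    (hUlm : AEStronglyMeasurable (uncurry Ul) (volume : Measure (ℝ × EuclideanSpace ℝ (Fin 3))))
    (hconv : ∀ n : ℕ, Tendsto (fun k => ∫⁻ z in Ioo (-((n : ℝ) + 1)) ((n : ℝ) + 1) ×ˢ
        ball (0 : EuclideanSpace ℝ (Fin 3)) (n + 1), ‖U k z.1 z.2 - Ul z.1 z.2‖ₑ ^ 2) atTop (𝓝 0))
    (hmoll : ∀ a b R : ℝ, Tendsto (fun k => eLpNorm (fun z : ℝ × EuclideanSpace ℝ (Fin 3) =>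
        mollify η (ε k) (U k) z.1 z.2 - Ul z.1 z.2) 3
        (volume.restrict (Ioo a b ×ˢ ball (0 : EuclideanSpace ℝ (Fin 3)) R))) atTop (𝓝 0))
    {pl : ℝ → EuclideanSpace ℝ (Fin 3) → ℝ}
    (hplm : AEStronglyMeasurable (uncurry pl) (volume : Measure (ℝ × EuclideanSpace ℝ (Fin 3))))
    (hpl53 : ∀ a b : ℝ, ∫⁻ z in Ioo a b ×ˢ (univ : Set (EuclideanSpace ℝ (Fin 3))), ‖pl z.1 z.2‖ₑ ^ (5 / 3 : ℝ) < ∞)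
    (hpw : ∀ (a b R : ℝ) (h : ℝ × EuclideanSpace ℝ (Fin 3) → ℝ),
      MemLp h (5 / 2 : ℝ≥0∞) (volume.restrict (Ioo a b ×ˢ ball (0 : EuclideanSpace ℝ (Fin 3)) R)) →
      Tendsto (fun k => ∫ z in Ioo a b ×ˢ ball (0 : EuclideanSpace ℝ (Fin 3)) R, p k z.1 z.2 * h z) atTop
        (𝓝 (∫ z in Ioo a b ×ˢ ball (0 : EuclideanSpace ℝ (Fin 3)) R, pl z.1 z.2 * h z)))
    (ψ : ℝ → EuclideanSpace ℝ (Fin 3) → EuclideanSpace ℝ (Fin 3))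
    (hψ : IsSpaceTimeTestOn (⊤ : Opens (ℝ × EuclideanSpace ℝ (Fin 3))) ψ) :
    ∫ z : ℝ × EuclideanSpace ℝ (Fin 3), (⟪Ul z.1 z.2 + W z.1 z.2, timeDeriv ψ z.1 z.2⟫ +
      ⟪Ul z.1 z.2 + W z.1 z.2, Δ (ψ z.1) z.2⟫ -
      ⟪Ul z.1 z.2 + W z.1 z.2, (2 : ℝ) • ψ z.1 z.2 + fderiv ℝ (ψ z.1) z.2 z.2⟫ +
      ⟪Ul z.1 z.2 + W z.1 z.2, convect (fun y => Ul z.1 y + W z.1 y) (ψ z.1) z.2⟫ +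
      pl z.1 z.2 * VectorCalculus.divergence (ψ z.1) z.2) = 0 := by
  -- ## the cylinder carrying `ψ`
  obtain ⟨n, hn⟩ := exists_subset_cylinder_of_isCompact hψ.hasCompactSupport
  set a : ℝ := -((n : ℝ) + 1) with ha
  set b : ℝ := (n : ℝ) + 1 with hb
  set R : ℝ := (n : ℝ) + 1 with hR
  set Q : Set (ℝ × EuclideanSpace ℝ (Fin 3)) := Ioo a b ×ˢ ball (0 : EuclideanSpace ℝ (Fin 3)) R with hQ
  have hQm : MeasurableSet Q := measurableSet_Ioo.prod measurableSet_ball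
  haveI : IsFiniteMeasure (volume.restrict Q) :=
    NSCylinder.isFiniteMeasure_restrict (Ω := ⟨ball (0 : EuclideanSpace ℝ (Fin 3)) R, isOpen_ball⟩) isBounded_ball a b
  set μQ : Measure (ℝ × EuclideanSpace ℝ (Fin 3)) := volume.restrict Q with hμQ
  have hsuppQ : tsupport (uncurry ψ) ⊆ Q := hn
  -- ## the weights
  obtain ⟨Cψ, hC0, htC, hDC, hΔC, hdivC⟩ := hψ.exists_weights_bound
  obtain ⟨C₀, hC₀0, hψC⟩ := exists_nonneg_bound_of_eq_zero_off_compact hψ.hasCompactSupport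
    (g := uncurry ψ) hψ.contDiff.continuous (fun z hz => image_eq_zero_of_notMem_tsupport hz)
  have hDyC := norm_fderiv_slice_apply_self_le hsuppQ hC0 hDC
  have htm : AEStronglyMeasurable (fun z : ℝ × EuclideanSpace ℝ (Fin 3) => timeDeriv ψ z.1 z.2) μQ :=
    hψ.continuous_timeDeriv.aestronglyMeasurable
  have hDm : AEStronglyMeasurable (fun z : ℝ × EuclideanSpace ℝ (Fin 3) => fderiv ℝ (ψ z.1) z.2) μQ :=
    hψ.continuous_fderiv_slice.aestronglyMeasurable
  have hΔm : AEStronglyMeasurable (fun z : ℝ × EuclideanSpace ℝ (Fin 3) => Δ (ψ z.1) z.2) μQ :=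
    hψ.continuous_laplacian_slice.aestronglyMeasurable
  have hdivm : AEStronglyMeasurable (fun z : ℝ × EuclideanSpace ℝ (Fin 3) => VectorCalculus.divergence (ψ z.1) z.2) μQ :=
    hψ.continuous_divergence_slice.aestronglyMeasurable
  have happ : Continuous (uncurry fun (L : EuclideanSpace ℝ (Fin 3) →L[ℝ] EuclideanSpace ℝ (Fin 3)) (v : EuclideanSpace ℝ (Fin 3)) => L v) :=
    isBoundedBilinearMap_apply.continuous
  have h3m : AEStronglyMeasurable (fun z : ℝ × EuclideanSpace ℝ (Fin 3) => (2 : ℝ) • ψ z.1 z.2 + fderiv ℝ (ψ z.1) z.2 z.2) μQ := by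
    refine (hψ.contDiff.continuous.aestronglyMeasurable.const_smul (2 : ℝ)).add ?_
    exact (happ.comp (hψ.continuous_fderiv_slice.prodMk continuous_snd)).aestronglyMeasurable
  have h3C : ∀ z : ℝ × EuclideanSpace ℝ (Fin 3), ‖(2 : ℝ) • ψ z.1 z.2 + fderiv ℝ (ψ z.1) z.2 z.2‖ ≤ 2 * C₀ + Cψ * |R| := fun z =>
    (norm_add_le _ _).trans (add_le_add (by rw [norm_smul, Real.norm_eq_abs, abs_of_pos two_pos]; exact mul_le_mul_of_nonneg_left (hψC z) zero_le_two)
      (hDyC z))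
  -- ## the profile on the cylinder
  obtain ⟨M, hM0, hMW, -⟩ := exists_profile_bound hW a b (0 : EuclideanSpace ℝ (Fin 3)) R
  have hWc : Continuous (uncurry W) := hW.continuous
  have hWm : AEStronglyMeasurable (fun z : ℝ × EuclideanSpace ℝ (Fin 3) => W z.1 z.2) μQ := hWc.aestronglyMeasurable.restrict
  have hWbd : ∀ᵐ z ∂μQ, ‖W z.1 z.2‖ ≤ M := by
    filter_upwards [ae_restrict_mem hQm] with z hz
    exact hMW z.1 (Ioo_subset_Icc_self hz.1) z.2 (ball_subset_closedBall hz.2)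
  have hWmem : MemLp (fun z : ℝ × EuclideanSpace ℝ (Fin 3) => W z.1 z.2) 2 μQ :=
    (memLp_top_of_bound hWm M hWbd).mono_exponent le_top
  -- ## the classes of the approximants and of the limit on the cylinder
  have hUmem : ∀ k, MemLp (fun z : ℝ × EuclideanSpace ℝ (Fin 3) => U k z.1 z.2) 2 μQ := fun k =>
    ((hsol k).cylinder_classes hWc hη (hε k) hMW).1
  have hmmem : ∀ k, MemLp (fun z : ℝ × EuclideanSpace ℝ (Fin 3) => mollify η (ε k) (U k) z.1 z.2) 2 μQ := fun k =>
    ((hsol k).cylinder_classes hWc hη (hε k) hMW).2.2.2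
  have hUm : ∀ k, AEStronglyMeasurable (uncurry (U k)) (volume : Measure (ℝ × EuclideanSpace ℝ (Fin 3))) :=
    fun k => (hsol k).aestronglyMeasurable_velocity
  obtain ⟨hUl2, -⟩ := locallyIntegrable_of_cylinder_limit (V := U) hUm
    (fun k m => ((hsol k).lintegral_cylinder_sq_le _ _ 0 _).trans_lt
      (ENNReal.mul_lt_top ENNReal.ofReal_lt_top ENNReal.coe_lt_top)) hUlm hconv
  have hUlmem : MemLp (fun z : ℝ × EuclideanSpace ℝ (Fin 3) => Ul z.1 z.2) 2 μQ := by
    refine ⟨hUlm.restrict, ?_⟩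
    rw [FunctionSpaces.AubinLions.eLpNorm_two_eq_rpow]
    exact ENNReal.rpow_lt_top_of_nonneg (by norm_num) (hUl2 n).ne
  have hukmem : ∀ k, MemLp (fun z : ℝ × EuclideanSpace ℝ (Fin 3) => U k z.1 z.2 + W z.1 z.2) 2 μQ := fun k => (hUmem k).add hWmem
  have humem : MemLp (fun z : ℝ × EuclideanSpace ℝ (Fin 3) => Ul z.1 z.2 + W z.1 z.2) 2 μQ := hUlmem.add hWmem
  have hbkmem : ∀ k, MemLp (fun z : ℝ × EuclideanSpace ℝ (Fin 3) => W z.1 z.2 + mollify η (ε k) (U k) z.1 z.2) 2 μQ :=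
    fun k => hWmem.add (hmmem k)
  have hbmem : MemLp (fun z : ℝ × EuclideanSpace ℝ (Fin 3) => W z.1 z.2 + Ul z.1 z.2) 2 μQ := hWmem.add hUlmem
  -- ## the convergences on the cylinder
  have hconvU : Tendsto (fun k => eLpNorm ((fun z : ℝ × EuclideanSpace ℝ (Fin 3) => U k z.1 z.2) - fun z => Ul z.1 z.2) 2 μQ) atTop (𝓝 0) :=
    FunctionSpaces.tendsto_eLpNorm_two_of_tendsto_lintegral_sq (f := fun k => uncurry (U k)) (g := uncurry Ul) (hconv n)
  have hconvu : Tendsto (fun k => eLpNorm ((fun z : ℝ × EuclideanSpace ℝ (Fin 3) => U k z.1 z.2 + W z.1 z.2) -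
      fun z => Ul z.1 z.2 + W z.1 z.2) 2 μQ) atTop (𝓝 0) := by
    refine hconvU.congr fun k => ?_
    congr 1
    funext z
    simp only [Pi.sub_apply]; abel
  have hconvm : Tendsto (fun k => eLpNorm ((fun z : ℝ × EuclideanSpace ℝ (Fin 3) => mollify η (ε k) (U k) z.1 z.2) -
      fun z => Ul z.1 z.2) 2 μQ) atTop (𝓝 0) :=
    tendsto_eLpNorm_two_of_three (fun k => (hmmem k).1.sub hUlmem.1) (hmoll a b R)
  have hconvb : Tendsto (fun k => eLpNorm ((fun z : ℝ × EuclideanSpace ℝ (Fin 3) => W z.1 z.2 + mollify η (ε k) (U k) z.1 z.2) -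
      fun z => W z.1 z.2 + Ul z.1 z.2) 2 μQ) atTop (𝓝 0) := by
    refine hconvm.congr fun k => ?_
    congr 1
    funext z
    simp only [Pi.sub_apply]; abel
  have hconvW : Tendsto (fun _ : ℕ => eLpNorm ((fun z : ℝ × EuclideanSpace ℝ (Fin 3) => W z.1 z.2) -
      fun z => W z.1 z.2) 2 μQ) atTop (𝓝 0) := by
    simp only [sub_self, eLpNorm_zero]; exact tendsto_const_nhds
  -- ## the pressures on the cylinder
  have hpki : ∀ k, Integrable (fun z : ℝ × EuclideanSpace ℝ (Fin 3) => p k z.1 z.2) μQ := fun k =>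
    (hsol k).integrable_cylinder_pressure hT a b 0 R
  have hpli : Integrable (fun z : ℝ × EuclideanSpace ℝ (Fin 3) => pl z.1 z.2) μQ :=
    integrable_of_lintegral_rpow_fiveThirds_lt_top hplm.restrict
      ((lintegral_mono_set (prod_mono Subset.rfl (subset_univ _))).trans_lt (hpl53 a b))
  have hdiv52 : MemLp (fun z : ℝ × EuclideanSpace ℝ (Fin 3) => VectorCalculus.divergence (ψ z.1) z.2) (5 / 2 : ℝ≥0∞) μQ :=
    (memLp_top_of_bound hdivm Cψ (Eventually.of_forall hdivC)).mono_exponent le_top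
  -- ## splitting of the tested integrand
  have hsplit : ∀ {w m : ℝ × EuclideanSpace ℝ (Fin 3) → EuclideanSpace ℝ (Fin 3)} {q : ℝ × EuclideanSpace ℝ (Fin 3) → ℝ},
      MemLp w 2 μQ → MemLp m 2 μQ → Integrable q μQ →
      ∫ z, (⟪w z + W z.1 z.2, timeDeriv ψ z.1 z.2⟫ + ⟪w z + W z.1 z.2, Δ (ψ z.1) z.2⟫ -
          ⟪w z + W z.1 z.2, (2 : ℝ) • ψ z.1 z.2 + fderiv ℝ (ψ z.1) z.2 z.2⟫ +
          ⟪w z, fderiv ℝ (ψ z.1) z.2 (W z.1 z.2 + m z)⟫ + ⟪W z.1 z.2, fderiv ℝ (ψ z.1) z.2 (w z + W z.1 z.2)⟫ +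
          q z * VectorCalculus.divergence (ψ z.1) z.2) ∂μQ =
        (∫ z, ⟪w z + W z.1 z.2, timeDeriv ψ z.1 z.2⟫ ∂μQ) + (∫ z, ⟪w z + W z.1 z.2, Δ (ψ z.1) z.2⟫ ∂μQ) -
          (∫ z, ⟪w z + W z.1 z.2, (2 : ℝ) • ψ z.1 z.2 + fderiv ℝ (ψ z.1) z.2 z.2⟫ ∂μQ) +
          (∫ z, ⟪w z, fderiv ℝ (ψ z.1) z.2 (W z.1 z.2 + m z)⟫ ∂μQ) +
          (∫ z, ⟪W z.1 z.2, fderiv ℝ (ψ z.1) z.2 (w z + W z.1 z.2)⟫ ∂μQ) +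
          ∫ z, q z * VectorCalculus.divergence (ψ z.1) z.2 ∂μQ := by
    intro w m q hw hm hq
    have hwW : MemLp (fun z => w z + W z.1 z.2) 2 μQ := hw.add hWmem
    have hwW1 : Integrable (fun z => w z + W z.1 z.2) μQ := hwW.integrable one_le_two
    -- linear pieces against bounded weights
    have hlin : ∀ {g : ℝ × EuclideanSpace ℝ (Fin 3) → EuclideanSpace ℝ (Fin 3)} {K : ℝ}, AEStronglyMeasurable g μQ → (∀ z, ‖g z‖ ≤ K) →
        Integrable (fun z => ⟪w z + W z.1 z.2, g z⟫) μQ := fun {g K} hg hgK =>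
      (hwW1.norm.mul_const K).mono' (hwW.1.inner hg) (Eventually.of_forall fun z =>
        (norm_inner_le_norm _ _).trans (mul_le_mul_of_nonneg_left (hgK z) (norm_nonneg _)))
    have i1 := hlin htm htC
    have i2 := hlin hΔm hΔC
    have i3 := hlin h3m h3C
    -- the drift piece
    have i4 : Integrable (fun z => ⟪w z, fderiv ℝ (ψ z.1) z.2 (W z.1 z.2 + m z)⟫) μQ := by
      have hb : MemLp (fun z => W z.1 z.2 + m z) 2 μQ := hWmem.add hm
      have hLb : MemLp (fun z => fderiv ℝ (ψ z.1) z.2 (W z.1 z.2 + m z)) 2 μQ :=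
        MemLp.of_le_mul (c := Cψ) hb (happ.comp_aestronglyMeasurable₂ hDm hb.1)
          (Eventually.of_forall fun z => (ContinuousLinearMap.le_opNorm _ _).trans
            (mul_le_mul_of_nonneg_right (hDC z) (norm_nonneg _)))
      have h1 : Integrable (fun z => ‖w z‖ * ‖fderiv ℝ (ψ z.1) z.2 (W z.1 z.2 + m z)‖) μQ := hw.norm.integrable_mul hLb.norm
      exact h1.mono' (hw.1.inner hLb.1) (Eventually.of_forall fun z => norm_inner_le_norm _ _)
    have i5 : Integrable (fun z => ⟪W z.1 z.2, fderiv ℝ (ψ z.1) z.2 (w z + W z.1 z.2)⟫) μQ := by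
      have hLb : MemLp (fun z => fderiv ℝ (ψ z.1) z.2 (w z + W z.1 z.2)) 2 μQ :=
        MemLp.of_le_mul (c := Cψ) hwW (happ.comp_aestronglyMeasurable₂ hDm hwW.1)
          (Eventually.of_forall fun z => (ContinuousLinearMap.le_opNorm _ _).trans
            (mul_le_mul_of_nonneg_right (hDC z) (norm_nonneg _)))
      have h1 : Integrable (fun z => ‖W z.1 z.2‖ * ‖fderiv ℝ (ψ z.1) z.2 (w z + W z.1 z.2)‖) μQ := hWmem.norm.integrable_mul hLb.norm
      exact h1.mono' (hWm.inner hLb.1) (Eventually.of_forall fun z => norm_inner_le_norm _ _)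
    have i6 : Integrable (fun z => q z * VectorCalculus.divergence (ψ z.1) z.2) μQ :=
      (hq.bdd_mul hdivm (Eventually.of_forall hdivC)).congr (Eventually.of_forall fun z => mul_comm _ _)
    have i12 : Integrable (fun z => ⟪w z + W z.1 z.2, timeDeriv ψ z.1 z.2⟫ + ⟪w z + W z.1 z.2, Δ (ψ z.1) z.2⟫) μQ := i1.add i2
    have i123 : Integrable (fun z => ⟪w z + W z.1 z.2, timeDeriv ψ z.1 z.2⟫ + ⟪w z + W z.1 z.2, Δ (ψ z.1) z.2⟫ -
        ⟪w z + W z.1 z.2, (2 : ℝ) • ψ z.1 z.2 + fderiv ℝ (ψ z.1) z.2 z.2⟫) μQ := i12.sub i3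
    have i1234 : Integrable (fun z => ⟪w z + W z.1 z.2, timeDeriv ψ z.1 z.2⟫ + ⟪w z + W z.1 z.2, Δ (ψ z.1) z.2⟫ -
        ⟪w z + W z.1 z.2, (2 : ℝ) • ψ z.1 z.2 + fderiv ℝ (ψ z.1) z.2 z.2⟫ +
        ⟪w z, fderiv ℝ (ψ z.1) z.2 (W z.1 z.2 + m z)⟫) μQ := i123.add i4
    have i12345 : Integrable (fun z => ⟪w z + W z.1 z.2, timeDeriv ψ z.1 z.2⟫ + ⟪w z + W z.1 z.2, Δ (ψ z.1) z.2⟫ -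
        ⟪w z + W z.1 z.2, (2 : ℝ) • ψ z.1 z.2 + fderiv ℝ (ψ z.1) z.2 z.2⟫ +
        ⟪w z, fderiv ℝ (ψ z.1) z.2 (W z.1 z.2 + m z)⟫ + ⟪W z.1 z.2, fderiv ℝ (ψ z.1) z.2 (w z + W z.1 z.2)⟫) μQ := i1234.add i5
    rw [integral_add i12345 i6, integral_add i1234 i5, integral_add i123 i4, integral_sub i12 i3, integral_add i1 i2]
  -- ## the approximate identities on the cylinder
  have hvanish : ∀ (w : ℝ → EuclideanSpace ℝ (Fin 3) → EuclideanSpace ℝ (Fin 3)) (B₁ B₂ : ℝ → EuclideanSpace ℝ (Fin 3) → EuclideanSpace ℝ (Fin 3))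
      (q : ℝ → EuclideanSpace ℝ (Fin 3) → ℝ) (z : ℝ × EuclideanSpace ℝ (Fin 3)), z ∉ Q →
      ⟪w z.1 z.2 + W z.1 z.2, timeDeriv ψ z.1 z.2⟫ + ⟪w z.1 z.2 + W z.1 z.2, Δ (ψ z.1) z.2⟫ -
        ⟪w z.1 z.2 + W z.1 z.2, (2 : ℝ) • ψ z.1 z.2 + fderiv ℝ (ψ z.1) z.2 z.2⟫ +
        ⟪w z.1 z.2, convect (B₁ z.1) (ψ z.1) z.2⟫ + ⟪W z.1 z.2, convect (B₂ z.1) (ψ z.1) z.2⟫ +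
        q z.1 z.2 * VectorCalculus.divergence (ψ z.1) z.2 = 0 := by
    intro w B₁ B₂ q z hz
    have hz' : z ∉ tsupport (uncurry ψ) := fun h => hz (hsuppQ h)
    obtain ⟨h1, h2, h3, h4, h5⟩ := testField_weights_eq_zero_of_notMem_tsupport hz'
    simp only [convect, h1, h2, h3, h4, h5, inner_zero_right, smul_zero, _root_.zero_apply, mul_zero,
      add_zero, sub_zero]
  have hk : ∀ k, (∫ z, ⟪U k z.1 z.2 + W z.1 z.2, timeDeriv ψ z.1 z.2⟫ ∂μQ) + (∫ z, ⟪U k z.1 z.2 + W z.1 z.2, Δ (ψ z.1) z.2⟫ ∂μQ) -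
      (∫ z, ⟪U k z.1 z.2 + W z.1 z.2, (2 : ℝ) • ψ z.1 z.2 + fderiv ℝ (ψ z.1) z.2 z.2⟫ ∂μQ) +
      (∫ z, ⟪U k z.1 z.2, fderiv ℝ (ψ z.1) z.2 (W z.1 z.2 + mollify η (ε k) (U k) z.1 z.2)⟫ ∂μQ) +
      (∫ z, ⟪W z.1 z.2, fderiv ℝ (ψ z.1) z.2 (U k z.1 z.2 + W z.1 z.2)⟫ ∂μQ) +
      ∫ z, p k z.1 z.2 * VectorCalculus.divergence (ψ z.1) z.2 ∂μQ = 0 := by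
    intro k
    have key := (hsol k).distributional ψ hψ
    rw [← setIntegral_eq_integral_of_forall_compl_eq_zero
      (hvanish (U k) (fun s => W s + mollify η (ε k) (U k) s) (fun s => U k s + W s) (p k))] at key
    rw [← hsplit (w := fun z => U k z.1 z.2) (m := fun z => mollify η (ε k) (U k) z.1 z.2) (q := fun z => p k z.1 z.2)
      (hUmem k) (hmmem k) (hpki k)]
    refine Eq.trans (integral_congr_ae (Eventually.of_forall fun z => ?_)) key
    simp only [convect, Pi.add_apply]
  -- ## the limits of the six pieces
  have hl1 : Tendsto (fun k => ∫ z, ⟪U k z.1 z.2 + W z.1 z.2, timeDeriv ψ z.1 z.2⟫ ∂μQ) atTop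
      (𝓝 (∫ z, ⟪Ul z.1 z.2 + W z.1 z.2, timeDeriv ψ z.1 z.2⟫ ∂μQ)) :=
    tendsto_integral_inner_of_tendsto_eLpNorm_two_bdd hukmem humem hconvu htm hC0 htC
  have hl2 : Tendsto (fun k => ∫ z, ⟪U k z.1 z.2 + W z.1 z.2, Δ (ψ z.1) z.2⟫ ∂μQ) atTop
      (𝓝 (∫ z, ⟪Ul z.1 z.2 + W z.1 z.2, Δ (ψ z.1) z.2⟫ ∂μQ)) :=
    tendsto_integral_inner_of_tendsto_eLpNorm_two_bdd hukmem humem hconvu hΔm hC0 hΔC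
  have hl3 : Tendsto (fun k => ∫ z, ⟪U k z.1 z.2 + W z.1 z.2, (2 : ℝ) • ψ z.1 z.2 + fderiv ℝ (ψ z.1) z.2 z.2⟫ ∂μQ) atTop
      (𝓝 (∫ z, ⟪Ul z.1 z.2 + W z.1 z.2, (2 : ℝ) • ψ z.1 z.2 + fderiv ℝ (ψ z.1) z.2 z.2⟫ ∂μQ)) :=
    tendsto_integral_inner_of_tendsto_eLpNorm_two_bdd hukmem humem hconvu h3m (by positivity) h3C
  have hl4 : Tendsto (fun k => ∫ z, ⟪U k z.1 z.2, fderiv ℝ (ψ z.1) z.2 (W z.1 z.2 + mollify η (ε k) (U k) z.1 z.2)⟫ ∂μQ) atTop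
      (𝓝 (∫ z, ⟪Ul z.1 z.2, fderiv ℝ (ψ z.1) z.2 (W z.1 z.2 + Ul z.1 z.2)⟫ ∂μQ)) :=
    tendsto_integral_inner_clm_apply₂ hUmem hUlmem hbkmem hbmem hconvU hconvb hDm hC0 hDC
  have hl5 : Tendsto (fun k => ∫ z, ⟪W z.1 z.2, fderiv ℝ (ψ z.1) z.2 (U k z.1 z.2 + W z.1 z.2)⟫ ∂μQ) atTop
      (𝓝 (∫ z, ⟪W z.1 z.2, fderiv ℝ (ψ z.1) z.2 (Ul z.1 z.2 + W z.1 z.2)⟫ ∂μQ)) :=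
    tendsto_integral_inner_clm_apply₂ (μ := μQ) (f := fun (_ : ℕ) (z : ℝ × EuclideanSpace ℝ (Fin 3)) => W z.1 z.2)
      (f₀ := fun z : ℝ × EuclideanSpace ℝ (Fin 3) => W z.1 z.2)
      (g := fun (k : ℕ) (z : ℝ × EuclideanSpace ℝ (Fin 3)) => U k z.1 z.2 + W z.1 z.2)
      (g₀ := fun z : ℝ × EuclideanSpace ℝ (Fin 3) => Ul z.1 z.2 + W z.1 z.2)
      (L := fun z : ℝ × EuclideanSpace ℝ (Fin 3) => fderiv ℝ (ψ z.1) z.2)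
      (fun _ => hWmem) hWmem hukmem humem hconvW hconvu hDm hC0 hDC
  have hl6 : Tendsto (fun k => ∫ z, p k z.1 z.2 * VectorCalculus.divergence (ψ z.1) z.2 ∂μQ) atTop
      (𝓝 (∫ z, pl z.1 z.2 * VectorCalculus.divergence (ψ z.1) z.2 ∂μQ)) := hpw a b R _ hdiv52
  have hlim := ((((hl1.add hl2).sub hl3).add hl4).add hl5).add hl6
  simp only [hk] at hlim
  have h0 := tendsto_nhds_unique tendsto_const_nhds hlim
  -- ## the limit identity
  have hvan2 : ∀ z : ℝ × EuclideanSpace ℝ (Fin 3), z ∉ Q →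
      ⟪Ul z.1 z.2 + W z.1 z.2, timeDeriv ψ z.1 z.2⟫ + ⟪Ul z.1 z.2 + W z.1 z.2, Δ (ψ z.1) z.2⟫ -
        ⟪Ul z.1 z.2 + W z.1 z.2, (2 : ℝ) • ψ z.1 z.2 + fderiv ℝ (ψ z.1) z.2 z.2⟫ +
        ⟪Ul z.1 z.2 + W z.1 z.2, convect (fun y => Ul z.1 y + W z.1 y) (ψ z.1) z.2⟫ +
        pl z.1 z.2 * VectorCalculus.divergence (ψ z.1) z.2 = 0 := by
    intro z hz
    have hz' : z ∉ tsupport (uncurry ψ) := fun h => hz (hsuppQ h)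
    obtain ⟨h1, h2, h3, h4, h5⟩ := testField_weights_eq_zero_of_notMem_tsupport hz'
    simp only [convect, h1, h2, h3, h4, h5, inner_zero_right, smul_zero, _root_.zero_apply, mul_zero,
      add_zero, sub_zero]
  rw [← setIntegral_eq_integral_of_forall_compl_eq_zero hvan2]
  have e : ∫ z in Q, (⟪Ul z.1 z.2 + W z.1 z.2, timeDeriv ψ z.1 z.2⟫ + ⟪Ul z.1 z.2 + W z.1 z.2, Δ (ψ z.1) z.2⟫ -
      ⟪Ul z.1 z.2 + W z.1 z.2, (2 : ℝ) • ψ z.1 z.2 + fderiv ℝ (ψ z.1) z.2 z.2⟫ +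
      ⟪Ul z.1 z.2, convect (fun y => Ul z.1 y + W z.1 y) (ψ z.1) z.2⟫ +
      ⟪W z.1 z.2, convect (fun y => Ul z.1 y + W z.1 y) (ψ z.1) z.2⟫ +
      pl z.1 z.2 * VectorCalculus.divergence (ψ z.1) z.2) =
      ∫ z, (⟪Ul z.1 z.2 + W z.1 z.2, timeDeriv ψ z.1 z.2⟫ + ⟪Ul z.1 z.2 + W z.1 z.2, Δ (ψ z.1) z.2⟫ -
        ⟪Ul z.1 z.2 + W z.1 z.2, (2 : ℝ) • ψ z.1 z.2 + fderiv ℝ (ψ z.1) z.2 z.2⟫ +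
        ⟪Ul z.1 z.2, fderiv ℝ (ψ z.1) z.2 (W z.1 z.2 + Ul z.1 z.2)⟫ +
        ⟪W z.1 z.2, fderiv ℝ (ψ z.1) z.2 (Ul z.1 z.2 + W z.1 z.2)⟫ +
        pl z.1 z.2 * VectorCalculus.divergence (ψ z.1) z.2) ∂μQ := by
    refine integral_congr_ae (Eventually.of_forall fun z => ?_)
    simp only [convect, add_comm (W z.1 z.2) (Ul z.1 z.2)]
  have e2 : ∫ z in Q, (⟪Ul z.1 z.2 + W z.1 z.2, timeDeriv ψ z.1 z.2⟫ + ⟪Ul z.1 z.2 + W z.1 z.2, Δ (ψ z.1) z.2⟫ -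
      ⟪Ul z.1 z.2 + W z.1 z.2, (2 : ℝ) • ψ z.1 z.2 + fderiv ℝ (ψ z.1) z.2 z.2⟫ +
      ⟪Ul z.1 z.2 + W z.1 z.2, convect (fun y => Ul z.1 y + W z.1 y) (ψ z.1) z.2⟫ +
      pl z.1 z.2 * VectorCalculus.divergence (ψ z.1) z.2) =
      ∫ z in Q, (⟪Ul z.1 z.2 + W z.1 z.2, timeDeriv ψ z.1 z.2⟫ + ⟪Ul z.1 z.2 + W z.1 z.2, Δ (ψ z.1) z.2⟫ -
        ⟪Ul z.1 z.2 + W z.1 z.2, (2 : ℝ) • ψ z.1 z.2 + fderiv ℝ (ψ z.1) z.2 z.2⟫ +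
        ⟪Ul z.1 z.2, convect (fun y => Ul z.1 y + W z.1 y) (ψ z.1) z.2⟫ +
        ⟪W z.1 z.2, convect (fun y => Ul z.1 y + W z.1 y) (ψ z.1) z.2⟫ +
        pl z.1 z.2 * VectorCalculus.divergence (ψ z.1) z.2) := by
    refine integral_congr_ae (Eventually.of_forall fun z => ?_)
    simp only [inner_add_left]
    ring
  rw [e2, e, hsplit hUlmem hUlmem hpli]
  exact h0.symm

end Distributional

/-! ### Divergence-free slices in the limit -/

section DivFree

/-- **The pairing `∫ ⟪v, ∇θ⟫` is integrable** for `v ∈ L²_loc` and a test function `θ`; its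
integral is over the closed ball carrying `∇θ`. [folklore] -/
theorem integrable_inner_gradient_of_local {v : EuclideanSpace ℝ (Fin 3) → EuclideanSpace ℝ (Fin 3)}
    (hvm : AEStronglyMeasurable v (volume : Measure (EuclideanSpace ℝ (Fin 3))))
    (hv2 : ∀ n : ℕ, ∫⁻ x in closedBall (0 : EuclideanSpace ℝ (Fin 3)) n, ‖v x‖ₑ ^ 2 < ∞)
    {θ : EuclideanSpace ℝ (Fin 3) → ℝ} (hθ : FunctionSpaces.IsTestFunctionOn (⊤ : Opens (EuclideanSpace ℝ (Fin 3))) θ) :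
    Integrable (fun x => ⟪v x, gradient θ x⟫) (volume : Measure (EuclideanSpace ℝ (Fin 3))) := by
  have hg : FunctionSpaces.IsTestFunctionOn (⊤ : Opens (EuclideanSpace ℝ (Fin 3))) (gradient θ) :=
    ⟨(InnerProductSpace.toDual ℝ (EuclideanSpace ℝ (Fin 3))).symm.contDiff.comp
      (hθ.contDiff.fderiv_right (m := (⊤ : ℕ∞)) (by exact_mod_cast le_top)),
     (hθ.hasCompactSupport.fderiv (𝕜 := ℝ)).comp_left
      (g := fun L => (InnerProductSpace.toDual ℝ (EuclideanSpace ℝ (Fin 3))).symm L) (by simp), by simp⟩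
  have hgc : Continuous (gradient θ) := hg.contDiff.continuous
  obtain ⟨r, hr⟩ := hg.hasCompactSupport.isCompact.isBounded.subset_closedBall (0 : EuclideanSpace ℝ (Fin 3))
  set n : ℕ := ⌈|r|⌉₊ with hn
  have hsub : tsupport (gradient θ) ⊆ closedBall (0 : EuclideanSpace ℝ (Fin 3)) n :=
    hr.trans (closedBall_subset_closedBall ((le_abs_self r).trans (Nat.le_ceil _)))
  obtain ⟨Cg, hCg⟩ := hgc.norm.bddAbove_range_of_hasCompactSupport hg.hasCompactSupport.norm
  have hCg' : ∀ x, ‖gradient θ x‖ ≤ Cg := fun x => hCg ⟨x, rfl⟩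
  have hvK : MemLp v 2 (volume.restrict (closedBall (0 : EuclideanSpace ℝ (Fin 3)) n)) := by
    refine ⟨hvm.restrict, ?_⟩
    rw [FunctionSpaces.AubinLions.eLpNorm_two_eq_rpow]
    exact ENNReal.rpow_lt_top_of_nonneg (by norm_num) (hv2 n).ne
  haveI : IsFiniteMeasure (volume.restrict (closedBall (0 : EuclideanSpace ℝ (Fin 3)) (n : ℝ))) :=
    ⟨by rw [Measure.restrict_apply_univ]; exact measure_closedBall_lt_top⟩
  have h1 : Integrable (fun x => ⟪v x, gradient θ x⟫) (volume.restrict (closedBall (0 : EuclideanSpace ℝ (Fin 3)) n)) :=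
    ((hvK.integrable one_le_two).norm.mul_const Cg).mono' (hvm.restrict.inner hgc.aestronglyMeasurable)
      (Eventually.of_forall fun x => (norm_inner_le_norm _ _).trans (mul_le_mul_of_nonneg_left (hCg' x) (norm_nonneg _)))
  refine (integrableOn_iff_integrable_of_support_subset (fun x hx => hsub (subset_tsupport _ ?_))).1 h1
  intro h0
  exact hx (show ⟪v x, gradient θ x⟫ = 0 by rw [h0, inner_zero_right])

/-- **The sum of two weakly divergence-free fields, one locally square integrable and one
continuous, is weakly divergence free.** [folklore] -/
theorem isWeaklyDivFree_add_of_continuous {v w : EuclideanSpace ℝ (Fin 3) → EuclideanSpace ℝ (Fin 3)}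
    (hv : IsWeaklyDivFree v) (hw : IsWeaklyDivFree w)
    (hvm : AEStronglyMeasurable v (volume : Measure (EuclideanSpace ℝ (Fin 3))))
    (hv2 : ∀ n : ℕ, ∫⁻ x in closedBall (0 : EuclideanSpace ℝ (Fin 3)) n, ‖v x‖ₑ ^ 2 < ∞) (hwc : Continuous w) :
    IsWeaklyDivFree (fun x => v x + w x) := by
  intro θ hθ
  have hg : FunctionSpaces.IsTestFunctionOn (⊤ : Opens (EuclideanSpace ℝ (Fin 3))) (gradient θ) :=
    ⟨(InnerProductSpace.toDual ℝ (EuclideanSpace ℝ (Fin 3))).symm.contDiff.comp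
      (hθ.contDiff.fderiv_right (m := (⊤ : ℕ∞)) (by exact_mod_cast le_top)),
     (hθ.hasCompactSupport.fderiv (𝕜 := ℝ)).comp_left
      (g := fun L => (InnerProductSpace.toDual ℝ (EuclideanSpace ℝ (Fin 3))).symm L) (by simp), by simp⟩
  have hgc : Continuous (gradient θ) := hg.contDiff.continuous
  have hiv := integrable_inner_gradient_of_local hvm hv2 hθ
  have hiw : Integrable (fun x => ⟪w x, gradient θ x⟫) (volume : Measure (EuclideanSpace ℝ (Fin 3))) := by
    refine (hwc.inner hgc).integrable_of_hasCompactSupport ?_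
    exact HasCompactSupport.intro hg.hasCompactSupport.isCompact fun x hx => by
      rw [image_eq_zero_of_notMem_tsupport hx, inner_zero_right]
  calc ∫ x, ⟪v x + w x, gradient θ x⟫ = ∫ x, (⟪v x, gradient θ x⟫ + ⟪w x, gradient θ x⟫) := by
        simp only [inner_add_left]
    _ = 0 := by rw [integral_add hiv hiw, hv θ hθ, hw θ hθ, add_zero]

/-- `∫ ‖f - g‖² ≤ 2 (∫ ‖f‖² + ∫ ‖g‖²)` on any set. [folklore] -/
theorem setLIntegral_enorm_sub_sq_le {X : Type*} [MeasurableSpace X] {μ : Measure X} {F : Type*} [NormedAddCommGroup F]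
    {f g : X → F} (hf : AEStronglyMeasurable f μ) (S : Set X) :
    ∫⁻ x in S, ‖f x - g x‖ₑ ^ 2 ∂μ ≤ 2 * (∫⁻ x in S, ‖f x‖ₑ ^ 2 ∂μ + ∫⁻ x in S, ‖g x‖ₑ ^ 2 ∂μ) := by
  calc ∫⁻ x in S, ‖f x - g x‖ₑ ^ 2 ∂μ ≤ ∫⁻ x in S, 2 * (‖f x‖ₑ ^ 2 + ‖g x‖ₑ ^ 2) ∂μ :=
        lintegral_mono fun x => FunctionSpaces.AubinLions.enorm_sub_sq_le _ _
    _ = 2 * (∫⁻ x in S, ‖f x‖ₑ ^ 2 ∂μ + ∫⁻ x in S, ‖g x‖ₑ ^ 2 ∂μ) := by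
        rw [lintegral_const_mul' _ _ ENNReal.ofNat_ne_top, lintegral_add_left' (hf.restrict.enorm.pow_const 2)]

/-- **Almost every slice of the limit is weakly divergence free** ([BT1], proof of Thm 2.4: the
limit `u = U + W` is divergence free). The slices `U_k(s)` are weakly divergence free for a.e.
`s`; `U_k → U` in `L²` of every cylinder gives, along a subsequence, `U_{k_j}(s) → U(s)` in
`L²(B(0, n+1))` for a.e. `s ∈ (−n−1, n+1)` (`AubinLions.exists_subseq_ae_tendsto_slice`), so the
pairings `∫ ⟪U(s), ∇θ⟫` vanish for every test function `θ` and a.e. `s`; the separability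
argument `ae_isWeaklyDivFree_of_forall_test` makes the null set independent of `θ`, and
`div W(s) = 0` classically (`VectorCalculus.IsDivFree.isWeaklyDivFree_holds`). [cite: BradshawTsai2017AHP, proof of Thm 2.4 (limit ε → 0)] -/
theorem ae_isWeaklyDivFree_limit {T : ℝ}
    {W : ℝ → EuclideanSpace ℝ (Fin 3) → EuclideanSpace ℝ (Fin 3)} (hW : ContDiff ℝ 1 (uncurry W))
    (hWdiv : ∀ s, VectorCalculus.IsDivFree (W s))
    {η : EuclideanSpace ℝ (Fin 3) → ℝ} {C : ℝ≥0} {ε : ℕ → ℝ}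
    {U : ℕ → ℝ → EuclideanSpace ℝ (Fin 3) → EuclideanSpace ℝ (Fin 3)} {p : ℕ → ℝ → EuclideanSpace ℝ (Fin 3) → ℝ}
    (hsol : ∀ k, IsMollifiedPeriodicWeakSolution T W η (ε k) C (U k) (p k))
    {Ul : ℝ → EuclideanSpace ℝ (Fin 3) → EuclideanSpace ℝ (Fin 3)}
    (hUlm : AEStronglyMeasurable (uncurry Ul) (volume : Measure (ℝ × EuclideanSpace ℝ (Fin 3))))
    (hUl2 : ∀ᵐ s : ℝ, ∫⁻ y, ‖Ul s y‖ₑ ^ 2 ≤ C)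
    (hconv : ∀ n : ℕ, Tendsto (fun k => ∫⁻ z in Ioo (-((n : ℝ) + 1)) ((n : ℝ) + 1) ×ˢ
        ball (0 : EuclideanSpace ℝ (Fin 3)) (n + 1), ‖U k z.1 z.2 - Ul z.1 z.2‖ₑ ^ 2) atTop (𝓝 0)) :
    ∀ᵐ s : ℝ, IsWeaklyDivFree (fun y => Ul s y + W s y) := by
  have hUm : ∀ k, AEStronglyMeasurable (uncurry (U k)) (volume : Measure (ℝ × EuclideanSpace ℝ (Fin 3))) :=
    fun k => (hsol k).aestronglyMeasurable_velocity
  -- slices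
  have hslm : ∀ᵐ s : ℝ, AEStronglyMeasurable (Ul s) (volume : Measure (EuclideanSpace ℝ (Fin 3))) := by
    have h := hUlm
    rw [Measure.volume_eq_prod] at h
    exact h.prodMk_left
  have hUkm : ∀ᵐ s : ℝ, ∀ k, AEStronglyMeasurable (U k s) (volume : Measure (EuclideanSpace ℝ (Fin 3))) :=
    ae_all_iff.2 fun k => (hsol k).ae_aestronglyMeasurable_slice
  have hdivk : ∀ᵐ s : ℝ, ∀ k, IsWeaklyDivFree (U k s) := ae_all_iff.2 fun k => (hsol k).divFree
  -- local square integrability of the limit on cylinders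
  obtain ⟨hUlQ, -⟩ := locallyIntegrable_of_cylinder_limit (V := U) hUm
    (fun k m => ((hsol k).lintegral_cylinder_sq_le _ _ 0 _).trans_lt
      (ENNReal.mul_lt_top ENNReal.ofReal_lt_top ENNReal.coe_lt_top)) hUlm hconv
  -- ## the `U`-part
  have hUl : ∀ᵐ s : ℝ, IsWeaklyDivFree (Ul s) := by
    refine ae_isWeaklyDivFree_of_forall_test (μ := volume) (v := Ul) ?_ ?_
    · filter_upwards [hslm, hUl2] with s hs h2
      exact ⟨hs, fun n => (setLIntegral_le_lintegral _ _).trans_lt (h2.trans_lt ENNReal.coe_lt_top)⟩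
    intro θ hθ
    have hg : FunctionSpaces.IsTestFunctionOn (⊤ : Opens (EuclideanSpace ℝ (Fin 3))) (gradient θ) :=
    ⟨(InnerProductSpace.toDual ℝ (EuclideanSpace ℝ (Fin 3))).symm.contDiff.comp
      (hθ.contDiff.fderiv_right (m := (⊤ : ℕ∞)) (by exact_mod_cast le_top)),
     (hθ.hasCompactSupport.fderiv (𝕜 := ℝ)).comp_left
      (g := fun L => (InnerProductSpace.toDual ℝ (EuclideanSpace ℝ (Fin 3))).symm L) (by simp), by simp⟩
    have hgc : Continuous (gradient θ) := hg.contDiff.continuous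
    obtain ⟨Cg, hCg⟩ := hgc.norm.bddAbove_range_of_hasCompactSupport hg.hasCompactSupport.norm
    have hCg' : ∀ x, ‖gradient θ x‖ ≤ Cg := fun x => hCg ⟨x, rfl⟩
    have hCg0 : 0 ≤ Cg := (norm_nonneg _).trans (hCg' 0)
    obtain ⟨r, hr⟩ := hg.hasCompactSupport.isCompact.isBounded.subset_closedBall (0 : EuclideanSpace ℝ (Fin 3))
    set n₀ : ℕ := ⌈|r|⌉₊ with hn₀
    -- on each time window `I n`, `n ≥ n₀`
    have hwin : ∀ n : ℕ, n₀ ≤ n → ∀ᵐ t : ℝ, t ∈ Ioo (-((n : ℝ) + 1)) ((n : ℝ) + 1) →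
        ∫ x, ⟪Ul t x, gradient θ x⟫ = 0 := by
      intro n hn
      set I : Set ℝ := Ioo (-((n : ℝ) + 1)) ((n : ℝ) + 1) with hI
      set B : Set (EuclideanSpace ℝ (Fin 3)) := ball (0 : EuclideanSpace ℝ (Fin 3)) (n + 1) with hB
      have hsuppB : tsupport (gradient θ) ⊆ B := by
        refine hr.trans (closedBall_subset_ball ?_)
        calc r ≤ |r| := le_abs_self r
          _ ≤ n₀ := Nat.le_ceil _
          _ ≤ n := by exact_mod_cast hn
          _ < n + 1 := lt_add_one _
      -- finiteness of the distances
      have hfin : ∀ k, ∫⁻ z in I ×ˢ B, ‖uncurry (U k) z - uncurry Ul z‖ₑ ^ 2 ≠ ⊤ := by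
        intro k
        refine ((setLIntegral_enorm_sub_sq_le (hUm k) _).trans_lt ?_).ne
        refine ENNReal.mul_lt_top ENNReal.ofNat_lt_top (ENNReal.add_lt_top.2 ⟨?_, hUlQ n⟩)
        exact ((hsol k).lintegral_cylinder_sq_le _ _ 0 _).trans_lt (ENNReal.mul_lt_top ENNReal.ofReal_lt_top ENNReal.coe_lt_top)
      obtain ⟨σ, -, hae⟩ := FunctionSpaces.AubinLions.exists_subseq_ae_tendsto_slice (I := I) (O := B)
        (f := fun k => uncurry (U k)) (g := uncurry Ul) (fun k => (hUm k).restrict) hUlm.restrict hfin (hconv n)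
      rw [ae_restrict_iff' measurableSet_Ioo] at hae
      filter_upwards [hae, hslm, hUkm, hdivk, hUl2] with t ht hts htk hdk h2 htI
      have hlim := ht htI
      -- the restricted measure on the ball
      haveI : IsFiniteMeasure ((volume : Measure (EuclideanSpace ℝ (Fin 3))).restrict B) :=
        ⟨by rw [Measure.restrict_apply_univ]; exact measure_ball_lt_top⟩
      have hUk2 : ∀ j, MemLp (U (σ j) t) 2 ((volume : Measure (EuclideanSpace ℝ (Fin 3))).restrict B) := fun j =>
        (MemLp.restrict B ⟨htk (σ j), (FunctionSpaces.AubinLions.eLpNorm_two_eq_rpow (U (σ j) t) volume).symm ▸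
          ENNReal.rpow_lt_top_of_nonneg (by norm_num) (((hsol (σ j)).energy_le t).trans_lt ENNReal.coe_lt_top).ne⟩)
      have hUlt2 : MemLp (Ul t) 2 ((volume : Measure (EuclideanSpace ℝ (Fin 3))).restrict B) :=
        MemLp.restrict B ⟨hts, (FunctionSpaces.AubinLions.eLpNorm_two_eq_rpow (Ul t) volume).symm ▸
          ENNReal.rpow_lt_top_of_nonneg (by norm_num) (h2.trans_lt ENNReal.coe_lt_top).ne⟩
      have hconvB : Tendsto (fun j => eLpNorm (U (σ j) t - Ul t) 2 ((volume : Measure (EuclideanSpace ℝ (Fin 3))).restrict B))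
          atTop (𝓝 0) :=
        FunctionSpaces.tendsto_eLpNorm_two_of_tendsto_lintegral_sq (f := fun j => U (σ j) t) (g := Ul t) hlim
      have hpair := tendsto_integral_inner_of_tendsto_eLpNorm_two_bdd hUk2 hUlt2 hconvB
        hgc.aestronglyMeasurable hCg0 hCg'
      -- from the ball to the whole space
      have hvan : ∀ (v : EuclideanSpace ℝ (Fin 3) → EuclideanSpace ℝ (Fin 3)) (x : EuclideanSpace ℝ (Fin 3)), x ∉ B →
          ⟪v x, gradient θ x⟫ = 0 := fun v x hx => by
        rw [image_eq_zero_of_notMem_tsupport (fun h => hx (hsuppB h)), inner_zero_right]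
      simp only [setIntegral_eq_integral_of_forall_compl_eq_zero (hvan _)] at hpair
      have h0 : (fun j => ∫ x, ⟪U (σ j) t x, gradient θ x⟫) = fun _ => 0 := funext fun j => hdk (σ j) θ hθ
      rw [h0] at hpair
      exact (tendsto_nhds_unique tendsto_const_nhds hpair).symm
    -- glue the windows
    have hall : ∀ᵐ t : ℝ, ∀ n : ℕ, n₀ ≤ n → t ∈ Ioo (-((n : ℝ) + 1)) ((n : ℝ) + 1) → ∫ x, ⟪Ul t x, gradient θ x⟫ = 0 := by
      rw [ae_all_iff]
      intro n
      by_cases hn : n₀ ≤ n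
      · filter_upwards [hwin n hn] with t ht _ using ht
      · exact Eventually.of_forall fun t h => absurd h hn
    filter_upwards [hall] with t ht
    set n : ℕ := max n₀ ⌈|t|⌉₊ with hn
    refine ht n (le_max_left _ _) ?_
    have h1 : |t| ≤ n := (Nat.le_ceil |t|).trans (by exact_mod_cast le_max_right n₀ ⌈|t|⌉₊)
    constructor <;> [linarith [neg_abs_le t]; linarith [le_abs_self t]]
  -- ## adding the profile
  have hW1 : ∀ s, ContDiff ℝ 1 (W s) := fun s => hW.comp (contDiff_const.prodMk contDiff_id)
  have hWc : ∀ s, Continuous (W s) := fun s => (hW1 s).continuous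
  filter_upwards [hUl, hslm, hUl2] with s h1 hsm h2
  exact isWeaklyDivFree_add_of_continuous h1 (VectorCalculus.IsDivFree.isWeaklyDivFree_holds (hWdiv s) (hW1 s)) hsm
    (fun n => (setLIntegral_le_lintegral _ _).trans_lt (h2.trans_lt ENNReal.coe_lt_top)) (hWc s)

end DivFree

end BradshawTsai2017

end Literature.Analysis.FluidPDE

end
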